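import Mathlib.LinearAlgebra.ExteriorPower.Basis
import Mathlib.LinearAlgebra.Determinant
import Mathlib.LinearAlgebra.Dimension.Free
import HarnessLib

/-!
# The top exterior power detects isomorphisms of free modules of the same finite rank

Topic `Literature/LinearAlgebra/Alternating` (sibling of `ExteriorPowerBaseChange`,
`ExteriorPowerDualPairing`), namespace `Literature.LinearAlgebra.Alternating`.

Bourbaki, *Algebra I*, Ch. III §7 no. 8 (Thm. 1 and Cor. 1: `⋀ⁿ` of a free module of rank `n` is
monogenous free on `e₁ ∧ ⋯ ∧ eₙ`), §8 no. 1 (Déf. 1, formulas (1) and (4): `⋀ⁿ u` is the homothety of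
ratio `det u`) and §8 no. 2 Thm. 1 (`u` bijective ⟺ `u` surjective ⟺ `det u` invertible); read for a
linear map between TWO based free modules of the same rank (held copy `book:bourbakind-algebra`,
pp. 522–523). For modules `M`, `N` over a
commutative ring `R` with bases `bM`, `bN` indexed by `Fin d` and a linear map `f : M → N`:

* `exteriorPower_basis_apply_eq_ιMulti` — the vector of Mathlib's basis `Module.Basis.exteriorPower d`
  of `⋀ᵈ M` (indexed by the unique `d`-subset of `Fin d`, whose increasing enumeration is the identity)
  is `b₁ ∧ ⋯ ∧ b_d = exteriorPower.ιMulti R d b`;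
* `exteriorPower_repr_ιMulti_eq_det` — the coordinate of `v₁ ∧ ⋯ ∧ v_d` on `b₁ ∧ ⋯ ∧ b_d` is
  `b.det v`; `eq_repr_smul_ιMulti`, `exists_eq_smul_ιMulti_basis` — every element of `⋀ᵈ M` is a multiple of
  `b₁ ∧ ⋯ ∧ b_d`;
  `smul_ιMulti_basis_eq_zero_iff`, `smul_ιMulti_basis_injective` — and `b₁ ∧ ⋯ ∧ b_d` is torsion-free
  (so `⋀ᵈ M` is free of rank one on it);
* `map_ιMulti_basis_eq_det_smul` — **`⋀ᵈ f (bM₁ ∧ ⋯ ∧ bM_d) = det (Mat_{bM,bN} f) • (bN₁ ∧ ⋯ ∧ bN_d)`**;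
* `bijective_iff_isUnit_det_toMatrix` — `f` is bijective iff `det (Mat_{bM,bN} f)` is a unit;
* `det_toMatrix_eq_of_map_ιMulti_eq_smul`, **`bijective_of_map_ιMulti_eq_smul`** — if `⋀ᵈ f` sends
  `bM₁ ∧ ⋯ ∧ bM_d` to `u • (bN₁ ∧ ⋯ ∧ bN_d)` then `u` is that determinant, and `f` is bijective as
  soon as `u` is a unit;
* `bijective_exteriorPower_map_of_bijective`, `bijective_of_surjective_exteriorPower_map`,
  **`bijective_iff_bijective_exteriorPower_map`**, `bijective_iff_surjective_exteriorPower_map` —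
  `f` bijective ⟺ `⋀ᵈ f` bijective ⟺ `⋀ᵈ f` surjective; and the basis-free forms
  `bijective_of_surjective_exteriorPower_map_of_finrank_eq`,
  `bijective_iff_bijective_exteriorPower_map_of_finrank_eq` for finite free modules of `finrank d`.

Road W of the `hodgecm-mathlib` cell (node (W0), the ω-argument: a morphism of smooth schemes whose
pull-back carries a generator of the top differentials to a unit multiple of a generator is étale)
consumes `bijective_of_map_ιMulti_eq_smul` through `Literature/RingTheory/Etale/`. Everything is
proved from Mathlib's `exteriorPower` API (`Module.Basis.exteriorPower`, `ιMultiDual_apply_ιMulti`,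
`map_apply_ιMulti`) and `LinearEquiv.ofIsUnitDet`; theorems only, no definitions, no named facts.

## References
* N. Bourbaki, *Algèbre, Chapitres 1 à 3* / *Algebra I*, Ch. III §7 no. 8 Thm. 1 & Cor. 1, §8 no. 1
  Déf. 1 (formulas (1), (4)), §8 no. 2 Thm. 1. [BourbakiAlgebre1a3]
-/

noncomputable section

open exteriorPower Module Function

namespace Literature.LinearAlgebra.Alternating

variable {R : Type*} [CommRing R] {M N : Type*} [AddCommGroup M] [Module R M]
  [AddCommGroup N] [Module R N] {d : ℕ}

/-! ### The top basis vector of `⋀ᵈ` is `b₁ ∧ ⋯ ∧ b_d` -/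

/-- A `d`-element subset of `Fin d` is everything (plumbing). [folklore] -/
private theorem coe_powersetCard_fin_eq_univ (s : Set.powersetCard (Fin d) d) :
    (s : Finset (Fin d)) = Finset.univ :=
  Finset.eq_univ_of_card _ (by rw [Set.powersetCard.card_eq, Fintype.card_fin])

/-- `Set.powersetCard (Fin d) d` has exactly one element (plumbing). [folklore] -/
private theorem powersetCard_fin_eq (s t : Set.powersetCard (Fin d) d) : s = t :=
  Set.powersetCard.eq_iff_subset.mpr (by rw [coe_powersetCard_fin_eq_univ t]; exact Finset.subset_univ _)

/-- `Set.powersetCard (Fin d) d` is inhabited, by `Finset.univ` (plumbing). [folklore] -/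
private theorem nonempty_powersetCard_fin : Nonempty (Set.powersetCard (Fin d) d) :=
  ⟨⟨Finset.univ, Set.powersetCard.mem_iff.mpr (by rw [Finset.card_univ, Fintype.card_fin])⟩⟩

/-- The increasing enumeration of the `d`-subset `univ` of `Fin d` is the identity (plumbing). [folklore] -/
private theorem ofFinEmbEquiv_symm_apply_of_fin (s : Set.powersetCard (Fin d) d) (i : Fin d) :
    Set.powersetCard.ofFinEmbEquiv.symm s i = i := by
  have h := Finset.orderEmbOfFin_unique (s := (s : Finset (Fin d))) s.prop (f := id)
    (fun x => by rw [coe_powersetCard_fin_eq_univ s]; exact Finset.mem_univ _) strictMono_id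
  rw [Set.powersetCard.ofFinEmbEquiv_symm_apply]
  exact (congrFun h i).symm

/-- **The vector of Mathlib's basis `b.exteriorPower d` of the top exterior power `⋀ᵈ M` of a module
with basis `b : Fin d → M` is `b₁ ∧ ⋯ ∧ b_d`** (Bourbaki: the `e_H`, `H = {1, …, n}`).
[cite: BourbakiAlgebre1a3, Ch. III §7 no. 8 Thm. 1] -/
theorem exteriorPower_basis_apply_eq_ιMulti (b : Basis (Fin d) R M) (s : Set.powersetCard (Fin d) d) :
    b.exteriorPower d s = ιMulti R d ⇑b := by
  rw [exteriorPower.basis_apply, ιMulti_family]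
  congr 1
  funext i
  rw [Function.comp_apply, ofFinEmbEquiv_symm_apply_of_fin]

/-- The coordinate of `v₁ ∧ ⋯ ∧ v_d` on the top basis vector `b₁ ∧ ⋯ ∧ b_d` is the determinant
`b.det v` of the coordinate matrix of `v` in `b` (Bourbaki's formula (4):
`x₁ ∧ ⋯ ∧ xₙ = det(x₁, …, xₙ) e₁ ∧ ⋯ ∧ eₙ`). [cite: BourbakiAlgebre1a3, Ch. III §8 no. 1 Déf. 1, formulas (1) and (4)] -/
theorem exteriorPower_repr_ιMulti_eq_det (b : Basis (Fin d) R M) (s : Set.powersetCard (Fin d) d)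
    (v : Fin d → M) : (b.exteriorPower d).repr (ιMulti R d v) s = b.det v := by
  rw [exteriorPower.basis_repr_apply, ιMultiDual_apply_ιMulti, Basis.det_apply, ← Matrix.det_transpose]
  congr 1
  ext i j
  rw [Matrix.transpose_apply, Matrix.of_apply, Basis.toMatrix_apply, Basis.coord_apply,
    ofFinEmbEquiv_symm_apply_of_fin]

/-- Every element of the top exterior power `⋀ᵈ M` is a multiple of `b₁ ∧ ⋯ ∧ b_d`, namely by its
coordinate (`⋀ⁿ M` is monogenous free on `e₁ ∧ ⋯ ∧ eₙ`). [cite: BourbakiAlgebre1a3, Ch. III §7 no. 8 Cor. 1 to Thm. 1] -/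
theorem eq_repr_smul_ιMulti (b : Basis (Fin d) R M) (s : Set.powersetCard (Fin d) d) (x : ⋀[R]^d M) :
    x = (b.exteriorPower d).repr x s • ιMulti R d ⇑b := by
  conv_lhs => rw [← (b.exteriorPower d).sum_repr x]
  rw [Fintype.sum_eq_single s (fun t ht => absurd (powersetCard_fin_eq t s) ht),
    exteriorPower_basis_apply_eq_ιMulti]

/-- Every element of `⋀ᵈ M` is a multiple of `b₁ ∧ ⋯ ∧ b_d` (`⋀ⁿ M` is monogenous free).
[cite: BourbakiAlgebre1a3, Ch. III §7 no. 8 Cor. 1 to Thm. 1] -/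
theorem exists_eq_smul_ιMulti_basis (b : Basis (Fin d) R M) (x : ⋀[R]^d M) : ∃ r : R, x = r • ιMulti R d ⇑b := by
  obtain ⟨s⟩ := nonempty_powersetCard_fin (d := d)
  exact ⟨_, eq_repr_smul_ιMulti b s x⟩

/-- `r ↦ r • (b₁ ∧ ⋯ ∧ b_d)` is injective (`⋀ᵈ M` is free of rank one on `b₁ ∧ ⋯ ∧ b_d`).
[cite: BourbakiAlgebre1a3, Ch. III §7 no. 8 Cor. 1 to Thm. 1] -/
theorem smul_ιMulti_basis_injective (b : Basis (Fin d) R M) :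
    Injective fun r : R => r • ιMulti R d ⇑b := fun r r' h => by
  obtain ⟨s⟩ := nonempty_powersetCard_fin (d := d)
  have h' := congrArg (fun x => (b.exteriorPower d).repr x s) h
  simpa only [← exteriorPower_basis_apply_eq_ιMulti b s, map_smul, Basis.repr_self,
    Finsupp.smul_single, smul_eq_mul, mul_one, Finsupp.single_eq_same] using h'

/-- `b₁ ∧ ⋯ ∧ b_d` is torsion-free in `⋀ᵈ M`: `r • (b₁ ∧ ⋯ ∧ b_d) = 0 ↔ r = 0` (free of rank one).
[cite: BourbakiAlgebre1a3, Ch. III §7 no. 8 Cor. 1 to Thm. 1] -/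
theorem smul_ιMulti_basis_eq_zero_iff (b : Basis (Fin d) R M) (r : R) :
    r • ιMulti R d ⇑b = 0 ↔ r = 0 := by
  refine ⟨fun h => smul_ιMulti_basis_injective b ?_, fun h => by rw [h, zero_smul]⟩
  change r • ιMulti R d ⇑b = (0 : R) • ιMulti R d ⇑b
  rw [h, zero_smul]

/-! ### `⋀ᵈ f` acts on the top vectors by the determinant -/

/-- **The top exterior power of a linear map is the determinant**: for bases `bM`, `bN` indexed by
`Fin d`, `⋀ᵈ f (bM₁ ∧ ⋯ ∧ bM_d) = det (Mat_{bM,bN} f) • (bN₁ ∧ ⋯ ∧ bN_d)` (Bourbaki's formula (1)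
`u(x₁) ∧ ⋯ ∧ u(xₙ) = (det u) · x₁ ∧ ⋯ ∧ xₙ`, read for a linear map between two based modules).
[cite: BourbakiAlgebre1a3, Ch. III §8 no. 1 Déf. 1, formulas (1) and (4)] -/
theorem map_ιMulti_basis_eq_det_smul (bM : Basis (Fin d) R M) (bN : Basis (Fin d) R N)
    (f : M →ₗ[R] N) :
    exteriorPower.map d f (ιMulti R d ⇑bM) = (LinearMap.toMatrix bM bN f).det • ιMulti R d ⇑bN := by
  obtain ⟨s⟩ := nonempty_powersetCard_fin (d := d)
  rw [map_apply_ιMulti, eq_repr_smul_ιMulti bN s (ιMulti R d (⇑f ∘ ⇑bM)),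
    exteriorPower_repr_ιMulti_eq_det, Basis.det_apply]
  congr 2
  ext i j
  rw [Basis.toMatrix_apply, LinearMap.toMatrix_apply, Function.comp_apply]

/-- A linear map between modules with bases indexed by the same finite type is bijective iff the
determinant of its matrix is a unit (Bourbaki: (a) ⟺ (e); Mathlib `LinearEquiv.ofIsUnitDet` /
`LinearEquiv.isUnit_det`). [cite: BourbakiAlgebre1a3, Ch. III §8 no. 2 Thm. 1] -/
theorem bijective_iff_isUnit_det_toMatrix {ι : Type*} [Fintype ι] [DecidableEq ι]
    (bM : Basis ι R M) (bN : Basis ι R N) (f : M →ₗ[R] N) :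
    Bijective f ↔ IsUnit (LinearMap.toMatrix bM bN f).det :=
  ⟨fun h => LinearEquiv.isUnit_det (LinearEquiv.ofBijective f h) bM bN,
    fun h => (LinearEquiv.ofIsUnitDet h).bijective⟩

/-- If `⋀ᵈ f` sends `bM₁ ∧ ⋯ ∧ bM_d` to `u • (bN₁ ∧ ⋯ ∧ bN_d)`, then `u = det (Mat_{bM,bN} f)` («det u is
the unique scalar such that (1) holds»). [cite: BourbakiAlgebre1a3, Ch. III §8 no. 1 Déf. 1, formulas (1) and (4)] -/
theorem det_toMatrix_eq_of_map_ιMulti_eq_smul (bM : Basis (Fin d) R M) (bN : Basis (Fin d) R N)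
    (f : M →ₗ[R] N) {u : R} (h : exteriorPower.map d f (ιMulti R d ⇑bM) = u • ιMulti R d ⇑bN) :
    (LinearMap.toMatrix bM bN f).det = u :=
  smul_ιMulti_basis_injective bN ((map_ιMulti_basis_eq_det_smul bM bN f).symm.trans h)

/-- **The top exterior power detects isomorphisms (unit-multiple form)**: if `⋀ᵈ f` sends
`bM₁ ∧ ⋯ ∧ bM_d` to a UNIT multiple of `bN₁ ∧ ⋯ ∧ bN_d`, then `f` is bijective (Bourbaki: (e) ⇒ (a)).
[cite: BourbakiAlgebre1a3, Ch. III §8 no. 2 Thm. 1] -/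
theorem bijective_of_map_ιMulti_eq_smul (bM : Basis (Fin d) R M) (bN : Basis (Fin d) R N)
    (f : M →ₗ[R] N) {u : R} (h : exteriorPower.map d f (ιMulti R d ⇑bM) = u • ιMulti R d ⇑bN)
    (hu : IsUnit u) : Bijective f := by
  rw [bijective_iff_isUnit_det_toMatrix bM bN, det_toMatrix_eq_of_map_ιMulti_eq_smul bM bN f h]
  exact hu

/-- `⋀ⁿ` of a bijective linear map is bijective (functoriality of `⋀ⁿ`, Bourbaki III §7 no. 2 formula (3);
the direction (a) ⇒ (d) on `⋀ⁿ`). [cite: BourbakiAlgebre1a3, Ch. III §8 no. 2 Thm. 1] -/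
theorem bijective_exteriorPower_map_of_bijective (n : ℕ) (f : M →ₗ[R] N) (hf : Bijective f) :
    Bijective (exteriorPower.map n f) := by
  let e : M ≃ₗ[R] N := LinearEquiv.ofBijective f hf
  have hfe : f = (e : M →ₗ[R] N) := rfl
  have h₁ : exteriorPower.map n (e.symm : N →ₗ[R] M) ∘ₗ exteriorPower.map n (e : M →ₗ[R] N) =
      LinearMap.id := by
    rw [← map_comp, e.symm_comp, map_id]
  have h₂ : exteriorPower.map n (e : M →ₗ[R] N) ∘ₗ exteriorPower.map n (e.symm : N →ₗ[R] M) =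
      LinearMap.id := by
    rw [← map_comp, e.comp_symm, map_id]
  rw [hfe]
  exact (LinearEquiv.ofLinear (exteriorPower.map n (e : M →ₗ[R] N))
    (exteriorPower.map n (e.symm : N →ₗ[R] M)) h₂ h₁ : (⋀[R]^n M) ≃ₗ[R] (⋀[R]^n N)).bijective

/-- **The top exterior power detects isomorphisms (surjective form)**: for free modules with bases
indexed by `Fin d`, if `⋀ᵈ f` is surjective then `f` is bijective (Bourbaki: «the homothety of ratio det u is
surjective, which immediately implies that det u is invertible», (d) ⇒ (e) ⇒ (a)). [cite: BourbakiAlgebre1a3, Ch. III §8 no. 2 Thm. 1] -/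
theorem bijective_of_surjective_exteriorPower_map (bM : Basis (Fin d) R M) (bN : Basis (Fin d) R N)
    (f : M →ₗ[R] N) (h : Surjective (exteriorPower.map d f)) : Bijective f := by
  obtain ⟨x, hx⟩ := h (ιMulti R d ⇑bN)
  obtain ⟨r, rfl⟩ := exists_eq_smul_ιMulti_basis bM x
  rw [map_smul, map_ιMulti_basis_eq_det_smul bM bN, smul_smul] at hx
  have h1 : r * (LinearMap.toMatrix bM bN f).det = 1 :=
    smul_ιMulti_basis_injective bN (hx.trans (one_smul R _).symm)
  exact (bijective_iff_isUnit_det_toMatrix bM bN f).mpr (.of_mul_eq_one _ ((mul_comm _ _).trans h1))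

/-- **`f` is bijective iff `⋀ᵈ f` is bijective** (free modules with bases indexed by `Fin d`).
[cite: BourbakiAlgebre1a3, Ch. III §8 no. 2 Thm. 1] -/
theorem bijective_iff_bijective_exteriorPower_map (bM : Basis (Fin d) R M) (bN : Basis (Fin d) R N)
    (f : M →ₗ[R] N) : Bijective f ↔ Bijective (exteriorPower.map d f) :=
  ⟨bijective_exteriorPower_map_of_bijective d f,
    fun h => bijective_of_surjective_exteriorPower_map bM bN f h.2⟩

/-- `f` is bijective iff `⋀ᵈ f` is surjective (free modules with bases indexed by `Fin d`).
[cite: BourbakiAlgebre1a3, Ch. III §8 no. 2 Thm. 1] -/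
theorem bijective_iff_surjective_exteriorPower_map (bM : Basis (Fin d) R M) (bN : Basis (Fin d) R N)
    (f : M →ₗ[R] N) : Bijective f ↔ Surjective (exteriorPower.map d f) :=
  ⟨fun h => (bijective_exteriorPower_map_of_bijective d f h).2,
    bijective_of_surjective_exteriorPower_map bM bN f⟩

/-! ### Basis-free forms for finite free modules of rank `d` -/

/-- **The top exterior power detects isomorphisms**, basis-free form: for finite free modules of
`finrank d`, `⋀ᵈ f` surjective ⇒ `f` bijective. [cite: BourbakiAlgebre1a3, Ch. III §8 no. 2 Thm. 1] -/
theorem bijective_of_surjective_exteriorPower_map_of_finrank_eq [Module.Free R M] [Module.Finite R M]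
    [Module.Free R N] [Module.Finite R N] (hM : finrank R M = d) (hN : finrank R N = d)
    (f : M →ₗ[R] N) (h : Surjective (exteriorPower.map d f)) : Bijective f := by
  rcases subsingleton_or_nontrivial R with hR | hR
  · haveI := Module.subsingleton R M
    haveI := Module.subsingleton R N
    exact ⟨injective_of_subsingleton _, fun y => ⟨0, Subsingleton.elim _ _⟩⟩
  · exact bijective_of_surjective_exteriorPower_map (finBasisOfFinrankEq R M hM)
      (finBasisOfFinrankEq R N hN) f h

/-- `f` bijective ⟺ `⋀ᵈ f` bijective, basis-free form for finite free modules of `finrank d`.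
[cite: BourbakiAlgebre1a3, Ch. III §8 no. 2 Thm. 1] -/
theorem bijective_iff_bijective_exteriorPower_map_of_finrank_eq [Module.Free R M] [Module.Finite R M]
    [Module.Free R N] [Module.Finite R N] (hM : finrank R M = d) (hN : finrank R N = d)
    (f : M →ₗ[R] N) : Bijective f ↔ Bijective (exteriorPower.map d f) :=
  ⟨bijective_exteriorPower_map_of_bijective d f,
    fun h => bijective_of_surjective_exteriorPower_map_of_finrank_eq hM hN f h.2⟩

end Literature.LinearAlgebra.Alternating

end
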